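import Summits.CriticalPhenomena.SAWScalingLimit.Theorems.SAWDevelopingMapHexTightExponentBootstrap
import HarnessLib

/-!
# (H1) from PER-SHELL tightness of the traversal number — crux `HexTight` (stmt-CriticalPhenomena-5423)

Crux `Summit.CriticalPhenomena.SAWScalingLimit.Theses.SAWDevelopingMap.HexTight`, line `reversal-virgin-disc`, seat c1
(`prover-line-stmt-CriticalPhenomena-5423-c1-0`). Companion of `SAWDevelopingMapHexTightExponentBootstrap.lean`.

**Statement (`traversalBound_of_perShellTight`).** For the critical SAW laws `hexSAWLaw Ω δ (a δ) (b δ)` of ANY domain and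
ANY endpoint family: if for EACH FIXED shell `D(x; ρ, R)` (`0 < ρ < R ≤ 1`) the number of separate traversals of the SAW
polyline is a TIGHT family as `δ → 0` — for every `η > 0` some threshold `k` and some `δ₁ > 0` with
`P_δ(k separate traversals) ≤ η` for all `δ ∈ (0, δ₁]`, `δ ≤ ρ`; no rate, no uniformity in the shell — then
Aizenman–Burchard's hypothesis (H1) holds with EVERY exponent `λ' > 0`, constant `4^{λ'}`, a threshold chosen per shell,
and for ALL meshes `0 < δ ≤ ρ` (no `δ₀`). Hence (`hexTight_of_perShellTight`, through the landed rung
`MarginalWedge.stub_hexTight_of_traversalBound`) **`HexTight` follows from per-shell tightness of the traversal numbers**,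
and for the line `reversal-virgin-disc` the interior and boundary regimes may each be supplied in this rate-free per-shell
form (`traversalBound_of_interior_perShell_of_boundary_perShell`). Since the refuter's `hexTraversalBound_of_crux`
(Cruxes/HexTight/DrefutePerShellTight.lean) shows the rung is an equivalence, the crux is EQUIVALENT to per-shell
tightness; the power law across shells and the uniform mesh bound of (H1) carry no content for lattice SAW.
(Prior art inside the crux: the drefute probe `DrefuteRVD.shellBound_of_perShellTight` (same work file) records the
rate-free half with a mesh range `(0, δ₀]` UNIFORM over shells and tolerances; here the mesh bound `δ₁` is allowed to
depend on the shell and on `η` — the literal "tight as `δ → 0`, shell by shell" — the coarse meshes being discharged by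
the cutoff, and the converse direction comes from the exponent bootstrap's net localization.)

**Proof.** The rate is manufactured by the threshold: for a thin shell (`4ρ < R`; thick ones are absorbed in `4^{λ'}`,
`embLaw_apply_le_one`) take `η := (ρ/R)^{λ'}` in the hypothesis, getting `(k, δ₁)`; below `δ₁` the hypothesis is the
bound; at the coarse meshes `δ ∈ [min δ₁ ρ, ρ]` the event with threshold `kc(x, ρ, R, min δ₁ ρ)` is EMPTY
(`ExponentBootstrap.exists_coarse_cutoff`: a SAW visits each of the finitely many faces that can lie in `B̄(x, ρ + δ)`
once); the shell's threshold is `max k kc`. No lattice estimate and no named fact is used.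

References: M. Aizenman, A. Burchard, Duke Math. J. 99 (1999) 419–453, §1.a–b (hypotheses H0/H1)
[AizenmanBurchardDuke1999]; H. Duminil-Copin, S. Smirnov, Ann. of Math. 175 (2012) §4 (the laws) [DuminilCopinSmirnov2012].
-/

noncomputable section

open scoped BigOperators Classical
open MeasureTheory Filter Topology Set Metric
open Literature.Probability.LatticeModels Literature.Probability.RandomPlanarGeometry
  Literature.Probability.RandomPlanarGeometry.SAW

namespace Summit.CriticalPhenomena.SAWScalingLimit.Theorems.HexTight.ExponentBootstrap

/-- **(H1) with every exponent from per-shell tightness of the traversal number.** For the critical hexagonal SAW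
laws of any domain and endpoint family: if for each fixed shell `D(x; ρ, R)`, `0 < ρ < R ≤ 1`, and each `η > 0` there are
a threshold `k` and a mesh bound `δ₁ > 0` with `P_δ(k separate traversals of D(x; ρ, R)) ≤ η` for all meshes
`δ ∈ (0, δ₁]`, `δ ≤ ρ`, then for every `λ' > 0` there is a threshold per shell with
`P_δ(k'(x,ρ,R) separate traversals) ≤ 4^{λ'} (ρ/R)^{λ'}` for ALL `0 < δ ≤ ρ < R ≤ 1`. (Take `η := (ρ/R)^{λ'}`; below
`δ₁` this is the hypothesis, at coarse meshes the event is empty by `exists_coarse_cutoff`.) -/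
theorem traversalBound_of_perShellTight :
    ∀ (Ω : Set ℂ) (a b : ℝ → HexVertex),
      (∀ (x : ℂ) (ρ R : ℝ), 0 < ρ → ρ < R → R ≤ 1 → ∀ η : ℝ, 0 < η → ∃ (k : ℕ) (δ₁ : ℝ), 0 < δ₁ ∧
        ∀ δ ∈ Set.Ioc (0 : ℝ) δ₁, δ ≤ ρ →
          hexSAWLaw Ω δ (a δ) (b δ)
            {γ | (⟨γ.walk.toCurve fun v => (δ : ℂ) * hexCenter v⟩ : Curve ℂ).HasTraversals k x ρ R} ≤
            ENNReal.ofReal η) →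
      ∀ (lam' : ℝ), 0 < lam' →
        ∃ k' : ℂ → ℝ → ℝ → ℕ, ∀ (δ : ℝ) (x : ℂ) (ρ R : ℝ), 0 < δ → δ ≤ ρ → ρ < R → R ≤ 1 →
          hexSAWLaw Ω δ (a δ) (b δ)
            {γ | (⟨γ.walk.toCurve fun v => (δ : ℂ) * hexCenter v⟩ : Curve ℂ).HasTraversals
              (k' x ρ R) x ρ R} ≤ ENNReal.ofReal (4 ^ lam' * (ρ / R) ^ lam') := by
  intro Ω a b h lam' hlam'
  -- one shell at a time
  suffices key : ∀ (x : ℂ) (ρ R : ℝ), ∃ kk : ℕ, ∀ δ : ℝ, 0 < δ → δ ≤ ρ → ρ < R → R ≤ 1 →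
      hexSAWLaw Ω δ (a δ) (b δ)
        {γ | (⟨γ.walk.toCurve fun v => (δ : ℂ) * hexCenter v⟩ : Curve ℂ).HasTraversals kk x ρ R} ≤
        ENNReal.ofReal (4 ^ lam' * (ρ / R) ^ lam') by
    choose kk hkk using key
    exact ⟨kk, fun δ x ρ R h₀ h₁ h₂ h₃ => hkk x ρ R δ h₀ h₁ h₂ h₃⟩
  intro x ρ R
  by_cases hshell : 0 < ρ ∧ ρ < R ∧ R ≤ 1
  swap
  · exact ⟨0, fun δ hδ hδρ hρR hR1 => (hshell ⟨hδ.trans_le hδρ, hρR, hR1⟩).elim⟩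
  obtain ⟨hρ, hρR, hR1⟩ := hshell
  have hR : 0 < R := hρ.trans hρR
  have ht0 : 0 < ρ / R := div_pos hρ hR
  have h4 : (1 : ℝ) ≤ 4 ^ lam' := Real.one_le_rpow (by norm_num) hlam'.le
  have hε : 0 < (ρ / R) ^ lam' := Real.rpow_pos_of_pos ht0 _
  -- thick shells are absorbed in the constant
  by_cases hthick : R ≤ 4 * ρ
  · refine ⟨0, fun δ _ _ _ _ => (embLaw_apply_le_one _).trans (ENNReal.one_le_ofReal.2 ?_)⟩
    rw [← Real.mul_rpow (by norm_num) ht0.le]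
    refine Real.one_le_rpow ?_ hlam'.le
    rw [mul_div_assoc', le_div_iff₀ hR]; linarith
  rw [not_le] at hthick
  -- thin shell: the hypothesis at tolerance `(ρ/R)^{λ'}`, and the coarse cutoff above its mesh bound
  obtain ⟨k, δ₁, hδ₁, hk⟩ := h x ρ R hρ hρR hR1 _ hε
  have hw : 0 < min δ₁ ρ := lt_min hδ₁ hρ
  obtain ⟨kc, hkc⟩ := exists_coarse_cutoff x ρ R (min δ₁ ρ) hw
  refine ⟨max k kc, fun δ hδ hδρ _ _ => ?_⟩
  by_cases hfine : δ ≤ δ₁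
  · calc hexSAWLaw Ω δ (a δ) (b δ) _
        ≤ hexSAWLaw Ω δ (a δ) (b δ)
            {γ | (⟨γ.walk.toCurve fun v => (δ : ℂ) * hexCenter v⟩ : Curve ℂ).HasTraversals k x ρ R} :=
          measure_mono fun γ hγ => Curve.HasTraversals.of_le hγ (le_max_left _ _)
      _ ≤ ENNReal.ofReal ((ρ / R) ^ lam') := hk δ ⟨hδ, hfine⟩ hδρ
      _ ≤ ENNReal.ofReal (4 ^ lam' * (ρ / R) ^ lam') :=
          ENNReal.ofReal_le_ofReal (le_mul_of_one_le_left hε.le h4)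
  · rw [not_le] at hfine
    have hempty : {γ : HexDomainSAW Ω δ (a δ) (b δ) |
        (⟨γ.walk.toCurve fun v => (δ : ℂ) * hexCenter v⟩ : Curve ℂ).HasTraversals (max k kc) x ρ R} = ∅ :=
      Set.eq_empty_of_forall_notMem fun γ hγ =>
        hkc Ω δ (a δ) (b δ) ((min_le_left _ _).trans hfine.le) hδρ (by linarith) γ
          (Curve.HasTraversals.of_le hγ (le_max_right _ _))
    rw [hempty, measure_empty]
    exact bot_le


/-- **Conversely, (H1) with some exponent `> 1` gives per-shell tightness** (the fine-mesh half of the exponent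
bootstrap; no cutoff needed because the mesh bound `δ₁` is chosen per shell and tolerance): localize on an `M`-point
net of the middle circle (`Curve.exists_net_hasTraversals_of_hasTraversals`) and take the union bound,
`M · K (C₀/M)^λ → 0` (`tendsto_unionBound`). Together with `traversalBound_of_perShellTight` and the refuter's
`hexTraversalBound_of_crux`: for the critical hexagonal SAW, (H1) with `λ > 2`, (H1) with any `λ > 1`, per-shell
tightness of the traversal numbers and the crux `HexTight` are all equivalent. -/
theorem perShellTight_of_traversalBound_one :
    ∀ (Ω : Set ℂ) (a b : ℝ → HexVertex) (k : ℂ → ℝ → ℝ → ℕ) (K lam δ₀ : ℝ), 0 ≤ K → 1 < lam → 0 < δ₀ →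
      (∀ δ ∈ Set.Ioc (0 : ℝ) δ₀, ∀ (x : ℂ) (ρ R : ℝ), δ ≤ ρ → ρ < R → R ≤ 1 →
        hexSAWLaw Ω δ (a δ) (b δ)
          {γ | (⟨γ.walk.toCurve fun v => (δ : ℂ) * hexCenter v⟩ : Curve ℂ).HasTraversals
            (k x ρ R) x ρ R} ≤ ENNReal.ofReal (K * (ρ / R) ^ lam)) →
      ∀ (x : ℂ) (ρ R : ℝ), 0 < ρ → ρ < R → R ≤ 1 → ∀ η : ℝ, 0 < η → ∃ (k' : ℕ) (δ₁ : ℝ), 0 < δ₁ ∧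
        ∀ δ ∈ Set.Ioc (0 : ℝ) δ₁, δ ≤ ρ →
          hexSAWLaw Ω δ (a δ) (b δ)
            {γ | (⟨γ.walk.toCurve fun v => (δ : ℂ) * hexCenter v⟩ : Curve ℂ).HasTraversals k' x ρ R} ≤
            ENNReal.ofReal η := by
  intro Ω a b k K lam δ₀ hK hlam hδ₀ h x ρ R hρ hρR hR1 η hη
  -- middle radius `m`, half width `hh`
  obtain ⟨m, hm⟩ : ∃ m : ℝ, m = (ρ + R) / 2 := ⟨_, rfl⟩
  obtain ⟨hh, hhh⟩ : ∃ hh : ℝ, hh = (R - ρ) / 2 := ⟨_, rfl⟩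
  have hmpos : 0 < m := by rw [hm]; linarith
  have hhpos : 0 < hh := by rw [hhh]; linarith
  have hh1 : hh ≤ 1 / 2 := by rw [hhh]; linarith
  -- the union-bound constant and the net size
  obtain ⟨C₀, hC₀⟩ : ∃ C₀ : ℝ, C₀ = 4 * Real.pi * m / hh := ⟨_, rfl⟩
  have hC₀pos : 0 < C₀ := by rw [hC₀]; positivity
  obtain ⟨M₀, hM₀⟩ := Filter.eventually_atTop.1
    ((tendsto_unionBound (K := K) hC₀pos.le hlam).eventually (Iio_mem_nhds hη))
  obtain ⟨M, hMdef⟩ : ∃ M : ℕ, M = max M₀ (⌈C₀⌉₊ + 1) := ⟨_, rfl⟩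
  have hMM₀ : M₀ ≤ M := hMdef ▸ le_max_left _ _
  have hMC : C₀ < M := by
    have h1 : ((⌈C₀⌉₊ + 1 : ℕ) : ℝ) ≤ M := by rw [hMdef]; exact_mod_cast le_max_right _ _
    have h2 : C₀ < ((⌈C₀⌉₊ + 1 : ℕ) : ℝ) := by
      push_cast; linarith [Nat.le_ceil C₀]
    linarith
  have hMpos : (0 : ℝ) < M := hC₀pos.trans hMC
  have hM1 : 1 ≤ M := by
    rw [hMdef]; exact le_max_of_le_right (Nat.succ_le_succ (Nat.zero_le _))
  have hsmall : (M : ℝ) * (K * (C₀ / M) ^ lam) < η := hM₀ M hMM₀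
  -- radii of the small shells
  obtain ⟨w, hw⟩ : ∃ w : ℝ, w = 2 * Real.pi * ((ρ + R) / 2) / M := ⟨_, rfl⟩
  have hw' : w = C₀ * hh / (2 * M) := by
    rw [hw, hC₀, ← hm]; field_simp; ring
  have hwpos : 0 < w := by rw [hw']; positivity
  have h2w : 2 * w < hh := by
    rw [hw', show C₀ * hh / (2 * M) = (C₀ / M) * hh / 2 by field_simp]
    have : C₀ / M < 1 := (div_lt_one hMpos).2 hMC
    nlinarith
  have hratio : w / (hh - w) ≤ C₀ / M := by
    have hden : hh / 2 ≤ hh - w := by linarith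
    calc w / (hh - w) ≤ w / (hh / 2) := div_le_div_of_nonneg_left hwpos.le (by positivity) hden
      _ = C₀ / M := by rw [hw']; field_simp
  -- net centres, threshold and mesh bound
  obtain ⟨c, hc⟩ : ∃ c : ℕ → ℂ, c = fun j : ℕ => x + (((ρ + R) / 2 : ℝ) : ℂ) *
      Complex.exp (((-Real.pi + 2 * Real.pi * (j : ℝ) / M : ℝ) : ℂ) * Complex.I) := ⟨_, rfl⟩
  refine ⟨∑ j ∈ Finset.range M, k (c j) w (hh - w), min w δ₀, lt_min hwpos hδ₀, fun δ hδ _ => ?_⟩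
  have hfine : δ ≤ w := hδ.2.trans (min_le_left _ _)
  have hδ' : δ ∈ Set.Ioc (0 : ℝ) δ₀ := ⟨hδ.1, hδ.2.trans (min_le_right _ _)⟩
  have hsub : {γ : HexDomainSAW Ω δ (a δ) (b δ) |
      (⟨γ.walk.toCurve fun v => (δ : ℂ) * hexCenter v⟩ : Curve ℂ).HasTraversals
        (∑ j ∈ Finset.range M, k (c j) w (hh - w)) x ρ R} ⊆
      ⋃ j ∈ Finset.range M, {γ | (⟨γ.walk.toCurve fun v => (δ : ℂ) * hexCenter v⟩ : Curve ℂ).HasTraversals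
        (k (c j) w (hh - w)) (c j) w (hh - w)} := by
    intro γ hγ
    obtain ⟨j, hj, hjT⟩ := Curve.exists_net_hasTraversals_of_hasTraversals hρ.le hρR hM1
      (fun j => k (c j) w (hh - w)) hγ
    refine Set.mem_iUnion₂.2 ⟨j, Finset.mem_range.2 hj, ?_⟩
    have e1 : (R - ρ) / 2 - w = hh - w := by rw [hhh]
    rw [← hw] at hjT
    rw [e1] at hjT
    simpa only [hc, Set.mem_setOf_eq] using hjT
  have hper : ∀ j ∈ Finset.range M,
      hexSAWLaw Ω δ (a δ) (b δ) {γ | (⟨γ.walk.toCurve fun v => (δ : ℂ) * hexCenter v⟩ : Curve ℂ).HasTraversals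
        (k (c j) w (hh - w)) (c j) w (hh - w)} ≤ ENNReal.ofReal (K * (C₀ / M) ^ lam) := by
    intro j _
    refine (h δ hδ' (c j) w (hh - w) hfine (by linarith) (by linarith)).trans
      (ENNReal.ofReal_le_ofReal (mul_le_mul_of_nonneg_left ?_ hK))
    exact Real.rpow_le_rpow (div_nonneg hwpos.le (by linarith)) hratio (by linarith)
  calc hexSAWLaw Ω δ (a δ) (b δ) _
      ≤ hexSAWLaw Ω δ (a δ) (b δ) (⋃ j ∈ Finset.range M, {γ |
          (⟨γ.walk.toCurve fun v => (δ : ℂ) * hexCenter v⟩ : Curve ℂ).HasTraversals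
            (k (c j) w (hh - w)) (c j) w (hh - w)}) := measure_mono hsub
    _ ≤ ∑ j ∈ Finset.range M, hexSAWLaw Ω δ (a δ) (b δ) {γ |
          (⟨γ.walk.toCurve fun v => (δ : ℂ) * hexCenter v⟩ : Curve ℂ).HasTraversals
            (k (c j) w (hh - w)) (c j) w (hh - w)} := measure_biUnion_finset_le _ _
    _ ≤ ∑ j ∈ Finset.range M, ENNReal.ofReal (K * (C₀ / M) ^ lam) := Finset.sum_le_sum hper
    _ = ENNReal.ofReal ((M : ℝ) * (K * (C₀ / M) ^ lam)) := by
        rw [Finset.sum_const, Finset.card_range, nsmul_eq_mul, ← ENNReal.ofReal_natCast M,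
          ← ENNReal.ofReal_mul (Nat.cast_nonneg M)]
    _ ≤ ENNReal.ofReal η := ENNReal.ofReal_le_ofReal hsmall.le

/-- **`HexTight` from per-shell tightness of the traversal numbers.** If for every Dobrushin domain and hexagonal
endpoint approximation, for each fixed shell the number of separate shell traversals of the critical SAW polyline is
tight as the mesh tends to `0` (rate-free, per shell), then the critical hexagonal SAW laws are eventually tight
(`…Theses.SAWDevelopingMap.HexTight`): `traversalBound_of_perShellTight` with `λ' = 3 > 2`, `δ₀ = 1`, then the
landed Aizenman–Burchard rung `MarginalWedge.stub_hexTight_of_traversalBound`. -/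
theorem hexTight_of_perShellTight
    (hT : ∀ (D : DobrushinDomain) (a b : ℝ → HexVertex), IsEmbEndpointApprox hexGraph hexCenter D a b →
      ∀ (x : ℂ) (ρ R : ℝ), 0 < ρ → ρ < R → R ≤ 1 → ∀ η : ℝ, 0 < η → ∃ (k : ℕ) (δ₁ : ℝ), 0 < δ₁ ∧
        ∀ δ ∈ Set.Ioc (0 : ℝ) δ₁, δ ≤ ρ →
          hexSAWLaw D.carrier δ (a δ) (b δ)
            {γ | (⟨γ.walk.toCurve fun v => (δ : ℂ) * hexCenter v⟩ : Curve ℂ).HasTraversals k x ρ R} ≤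
            ENNReal.ofReal η) :
    Summit.CriticalPhenomena.SAWScalingLimit.Theses.SAWDevelopingMap.HexTight := by
  refine HexConjecture.MarginalWedge.stub_hexTight_of_traversalBound fun D a b hab => ?_
  obtain ⟨k', hk'⟩ := traversalBound_of_perShellTight D.carrier a b (hT D a b hab) 3 (by norm_num)
  exact ⟨k', 4 ^ (3 : ℝ), 3, 1, by positivity, by norm_num, one_pos,
    fun δ hδ x ρ R h₁ h₂ h₃ => hk' δ x ρ R hδ.1 h₁ h₂ h₃⟩

/-- **Interior + boundary per-shell tightness give (H1) with exponent `3 > 2`** (the composition shape of the line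
`reversal-virgin-disc`, rate-free on both sides): per-shell tightness on interior shells (`closedBall x R ⊆ Ω`) and on
boundary shells (`closedBall x R ⊄ Ω`) is per-shell tightness on all shells, whence the `λ = 3`, `δ₀ = 1` form of
`HexTraversalBound`. -/
theorem traversalBound_of_interior_perShell_of_boundary_perShell {Ω : Set ℂ} {a b : ℝ → HexVertex}
    (hI : ∀ (x : ℂ) (ρ R : ℝ), 0 < ρ → ρ < R → R ≤ 1 → Metric.closedBall x R ⊆ Ω → ∀ η : ℝ, 0 < η →
      ∃ (k : ℕ) (δ₁ : ℝ), 0 < δ₁ ∧ ∀ δ ∈ Set.Ioc (0 : ℝ) δ₁, δ ≤ ρ →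
        hexSAWLaw Ω δ (a δ) (b δ)
          {γ | (⟨γ.walk.toCurve fun v => (δ : ℂ) * hexCenter v⟩ : Curve ℂ).HasTraversals k x ρ R} ≤
          ENNReal.ofReal η)
    (hB : ∀ (x : ℂ) (ρ R : ℝ), 0 < ρ → ρ < R → R ≤ 1 → ¬ Metric.closedBall x R ⊆ Ω → ∀ η : ℝ, 0 < η →
      ∃ (k : ℕ) (δ₁ : ℝ), 0 < δ₁ ∧ ∀ δ ∈ Set.Ioc (0 : ℝ) δ₁, δ ≤ ρ →
        hexSAWLaw Ω δ (a δ) (b δ)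
          {γ | (⟨γ.walk.toCurve fun v => (δ : ℂ) * hexCenter v⟩ : Curve ℂ).HasTraversals k x ρ R} ≤
          ENNReal.ofReal η) :
    ∃ (k : ℂ → ℝ → ℝ → ℕ) (K lam δ₀ : ℝ), 0 ≤ K ∧ 2 < lam ∧ 0 < δ₀ ∧
      ∀ δ ∈ Set.Ioc (0 : ℝ) δ₀, ∀ (x : ℂ) (ρ R : ℝ), δ ≤ ρ → ρ < R → R ≤ 1 →
        hexSAWLaw Ω δ (a δ) (b δ)
          {γ | (⟨γ.walk.toCurve fun v => (δ : ℂ) * hexCenter v⟩ : Curve ℂ).HasTraversals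
            (k x ρ R) x ρ R} ≤ ENNReal.ofReal (K * (ρ / R) ^ lam) := by
  have hall : ∀ (x : ℂ) (ρ R : ℝ), 0 < ρ → ρ < R → R ≤ 1 → ∀ η : ℝ, 0 < η → ∃ (k : ℕ) (δ₁ : ℝ), 0 < δ₁ ∧
      ∀ δ ∈ Set.Ioc (0 : ℝ) δ₁, δ ≤ ρ →
        hexSAWLaw Ω δ (a δ) (b δ)
          {γ | (⟨γ.walk.toCurve fun v => (δ : ℂ) * hexCenter v⟩ : Curve ℂ).HasTraversals k x ρ R} ≤
          ENNReal.ofReal η := by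
    intro x ρ R hρ hρR hR1 η hη
    by_cases hin : Metric.closedBall x R ⊆ Ω
    · exact hI x ρ R hρ hρR hR1 hin η hη
    · exact hB x ρ R hρ hρR hR1 hin η hη
  obtain ⟨k', hk'⟩ := traversalBound_of_perShellTight Ω a b hall 3 (by norm_num)
  exact ⟨k', 4 ^ (3 : ℝ), 3, 1, by positivity, by norm_num, one_pos,
    fun δ hδ x ρ R h₁ h₂ h₃ => hk' δ x ρ R hδ.1 h₁ h₂ h₃⟩


/-! ### Versions on a selected class of shells (interior / boundary), in the shapes of the crux skeleton -/

/-- **Per-shell tightness on a class of shells ⇒ the traversal bound with every exponent on that class**, all meshes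
`0 < δ ≤ ρ` (the proof of `traversalBound_of_perShellTight` is shell by shell, so any predicate `good x R` selecting
the shells — interior `closedBall x R ⊆ Ω`, boundary `¬ closedBall x R ⊆ Ω`, all `True` — threads through). -/
theorem shellBound_of_perShellTight_on (good : ℂ → ℝ → Prop) :
    ∀ (Ω : Set ℂ) (a b : ℝ → HexVertex),
      (∀ (x : ℂ) (ρ R : ℝ), 0 < ρ → ρ < R → R ≤ 1 → good x R → ∀ η : ℝ, 0 < η → ∃ (k : ℕ) (δ₁ : ℝ), 0 < δ₁ ∧
        ∀ δ ∈ Set.Ioc (0 : ℝ) δ₁, δ ≤ ρ →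
          hexSAWLaw Ω δ (a δ) (b δ)
            {γ | (⟨γ.walk.toCurve fun v => (δ : ℂ) * hexCenter v⟩ : Curve ℂ).HasTraversals k x ρ R} ≤
            ENNReal.ofReal η) →
      ∀ (lam' : ℝ), 0 < lam' →
        ∃ k' : ℂ → ℝ → ℝ → ℕ, ∀ (δ : ℝ) (x : ℂ) (ρ R : ℝ), 0 < δ → δ ≤ ρ → ρ < R → R ≤ 1 → good x R →
          hexSAWLaw Ω δ (a δ) (b δ)
            {γ | (⟨γ.walk.toCurve fun v => (δ : ℂ) * hexCenter v⟩ : Curve ℂ).HasTraversals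
              (k' x ρ R) x ρ R} ≤ ENNReal.ofReal (4 ^ lam' * (ρ / R) ^ lam') := by
  intro Ω a b h lam' hlam'
  -- one shell at a time
  suffices key : ∀ (x : ℂ) (ρ R : ℝ), ∃ kk : ℕ, ∀ δ : ℝ, 0 < δ → δ ≤ ρ → ρ < R → R ≤ 1 → good x R →
      hexSAWLaw Ω δ (a δ) (b δ)
        {γ | (⟨γ.walk.toCurve fun v => (δ : ℂ) * hexCenter v⟩ : Curve ℂ).HasTraversals kk x ρ R} ≤
        ENNReal.ofReal (4 ^ lam' * (ρ / R) ^ lam') by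
    choose kk hkk using key
    exact ⟨kk, fun δ x ρ R h₀ h₁ h₂ h₃ h₄ => hkk x ρ R δ h₀ h₁ h₂ h₃ h₄⟩
  intro x ρ R
  by_cases hshell : 0 < ρ ∧ ρ < R ∧ R ≤ 1 ∧ good x R
  swap
  · exact ⟨0, fun δ hδ hδρ hρR hR1 hg => (hshell ⟨hδ.trans_le hδρ, hρR, hR1, hg⟩).elim⟩
  obtain ⟨hρ, hρR, hR1, hg⟩ := hshell
  have hR : 0 < R := hρ.trans hρR
  have ht0 : 0 < ρ / R := div_pos hρ hR
  have h4 : (1 : ℝ) ≤ 4 ^ lam' := Real.one_le_rpow (by norm_num) hlam'.le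
  have hε : 0 < (ρ / R) ^ lam' := Real.rpow_pos_of_pos ht0 _
  by_cases hthick : R ≤ 4 * ρ
  · refine ⟨0, fun δ _ _ _ _ _ => (embLaw_apply_le_one _).trans (ENNReal.one_le_ofReal.2 ?_)⟩
    rw [← Real.mul_rpow (by norm_num) ht0.le]
    refine Real.one_le_rpow ?_ hlam'.le
    rw [mul_div_assoc', le_div_iff₀ hR]; linarith
  rw [not_le] at hthick
  obtain ⟨k, δ₁, hδ₁, hk⟩ := h x ρ R hρ hρR hR1 hg _ hε
  have hw : 0 < min δ₁ ρ := lt_min hδ₁ hρ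
  obtain ⟨kc, hkc⟩ := exists_coarse_cutoff x ρ R (min δ₁ ρ) hw
  refine ⟨max k kc, fun δ hδ hδρ _ _ _ => ?_⟩
  by_cases hfine : δ ≤ δ₁
  · calc hexSAWLaw Ω δ (a δ) (b δ) _
        ≤ hexSAWLaw Ω δ (a δ) (b δ)
            {γ | (⟨γ.walk.toCurve fun v => (δ : ℂ) * hexCenter v⟩ : Curve ℂ).HasTraversals k x ρ R} :=
          measure_mono fun γ hγ => Curve.HasTraversals.of_le hγ (le_max_left _ _)
      _ ≤ ENNReal.ofReal ((ρ / R) ^ lam') := hk δ ⟨hδ, hfine⟩ hδρ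
      _ ≤ ENNReal.ofReal (4 ^ lam' * (ρ / R) ^ lam') :=
          ENNReal.ofReal_le_ofReal (le_mul_of_one_le_left hε.le h4)
  · rw [not_le] at hfine
    have hempty : {γ : HexDomainSAW Ω δ (a δ) (b δ) |
        (⟨γ.walk.toCurve fun v => (δ : ℂ) * hexCenter v⟩ : Curve ℂ).HasTraversals (max k kc) x ρ R} = ∅ :=
      Set.eq_empty_of_forall_notMem fun γ hγ =>
        hkc Ω δ (a δ) (b δ) ((min_le_left _ _).trans hfine.le) hδρ (by linarith) γ
          (Curve.HasTraversals.of_le hγ (le_max_right _ _))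
    rw [hempty, measure_empty]
    exact bot_le

/-- **Boundary per-shell tightness ⇒ the boundary-shells bound of the crux skeleton** (`BoundaryShellBound D a b`
of `Cruxes/HexTight/Lines/reversal_virgin_disc.lean`, with `Ω = D.carrier`: `K = 4³`, `lam = 3 > 2`, `δ₀ = 1`).
One-line adoption for the lead: `stub_boundaryShells D a b hab := boundaryShellBound_of_perShellTight (h D a b hab)`
with `h` a boundary per-shell tightness stub. -/
theorem boundaryShellBound_of_perShellTight {Ω : Set ℂ} {a b : ℝ → HexVertex}
    (hB : ∀ (x : ℂ) (ρ R : ℝ), 0 < ρ → ρ < R → R ≤ 1 → ¬ Metric.closedBall x R ⊆ Ω → ∀ η : ℝ, 0 < η →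
      ∃ (k : ℕ) (δ₁ : ℝ), 0 < δ₁ ∧ ∀ δ ∈ Set.Ioc (0 : ℝ) δ₁, δ ≤ ρ →
        hexSAWLaw Ω δ (a δ) (b δ)
          {γ | (⟨γ.walk.toCurve fun v => (δ : ℂ) * hexCenter v⟩ : Curve ℂ).HasTraversals k x ρ R} ≤
          ENNReal.ofReal η) :
    ∃ (k : ℂ → ℝ → ℝ → ℕ) (K lam δ₀ : ℝ), 0 ≤ K ∧ 2 < lam ∧ 0 < δ₀ ∧
      ∀ δ ∈ Set.Ioc (0 : ℝ) δ₀, ∀ (x : ℂ) (ρ R : ℝ), δ ≤ ρ → ρ < R → R ≤ 1 →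
        ¬ Metric.closedBall x R ⊆ Ω →
        hexSAWLaw Ω δ (a δ) (b δ)
          {γ | (⟨γ.walk.toCurve fun v => (δ : ℂ) * hexCenter v⟩ : Curve ℂ).HasTraversals
            (k x ρ R) x ρ R} ≤ ENNReal.ofReal (K * (ρ / R) ^ lam) := by
  obtain ⟨k', hk'⟩ := shellBound_of_perShellTight_on (fun x R => ¬ Metric.closedBall x R ⊆ Ω) Ω a b hB 3
    (by norm_num)
  exact ⟨k', 4 ^ (3 : ℝ), 3, 1, by positivity, by norm_num, one_pos,
    fun δ hδ x ρ R h₁ h₂ h₃ h₄ => hk' δ x ρ R hδ.1 h₁ h₂ h₃ h₄⟩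

/-- **Interior per-shell tightness ⇒ the interior-shells bound of the crux skeleton** (`InteriorShellBound D a b`,
same constants). -/
theorem interiorShellBound_of_perShellTight {Ω : Set ℂ} {a b : ℝ → HexVertex}
    (hI : ∀ (x : ℂ) (ρ R : ℝ), 0 < ρ → ρ < R → R ≤ 1 → Metric.closedBall x R ⊆ Ω → ∀ η : ℝ, 0 < η →
      ∃ (k : ℕ) (δ₁ : ℝ), 0 < δ₁ ∧ ∀ δ ∈ Set.Ioc (0 : ℝ) δ₁, δ ≤ ρ →
        hexSAWLaw Ω δ (a δ) (b δ)
          {γ | (⟨γ.walk.toCurve fun v => (δ : ℂ) * hexCenter v⟩ : Curve ℂ).HasTraversals k x ρ R} ≤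
          ENNReal.ofReal η) :
    ∃ (k : ℂ → ℝ → ℝ → ℕ) (K lam δ₀ : ℝ), 0 ≤ K ∧ 2 < lam ∧ 0 < δ₀ ∧
      ∀ δ ∈ Set.Ioc (0 : ℝ) δ₀, ∀ (x : ℂ) (ρ R : ℝ), δ ≤ ρ → ρ < R → R ≤ 1 →
        Metric.closedBall x R ⊆ Ω →
        hexSAWLaw Ω δ (a δ) (b δ)
          {γ | (⟨γ.walk.toCurve fun v => (δ : ℂ) * hexCenter v⟩ : Curve ℂ).HasTraversals
            (k x ρ R) x ρ R} ≤ ENNReal.ofReal (K * (ρ / R) ^ lam) := by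
  obtain ⟨k', hk'⟩ := shellBound_of_perShellTight_on (fun x R => Metric.closedBall x R ⊆ Ω) Ω a b hI 3
    (by norm_num)
  exact ⟨k', 4 ^ (3 : ℝ), 3, 1, by positivity, by norm_num, one_pos,
    fun δ hδ x ρ R h₁ h₂ h₃ h₄ => hk' δ x ρ R hδ.1 h₁ h₂ h₃ h₄⟩

end Summit.CriticalPhenomena.SAWScalingLimit.Theorems.HexTight.ExponentBootstrap

end
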